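import Mathlib

/-!
# `Balaban1983to89.B14Ineq39` — CMP 119 (3.9) p. 266: in the axial gauge for `V^{(k)}_□`,
# `|V_k(y,x) − 1| = |V_k(y,x)(V^{(k)}_□(y,x))⁻¹ − 1| < O(1)δ_k = O(1)(A₁/A₀)ε_k < ε_k`, "Thus χ_Ax((Ω~_{k+1})^{(k)}) = 1"
# — typed in the scalar style of `B14Sect3.Ineq38Printed` ((3.8)) and PROVED: the product estimate behind "O(1)δ_k",
# the identity `δ_k = (A₁/A₀)ε_k` step, and the smallness step "for A₁/A₀ sufficiently small"

statement-level skeleton of published theorems with citation tags; proofs where landed; nothing here is a claim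
about the Yang–Mills mass gap.

CITATION HEADER (lean-in-tree rule).  Source: T. Bałaban, *Convergent renormalization expansions for lattice gauge
theories*, Commun. Math. Phys. **119**, 243–285 (1988), doi:10.1007/bf01217741 [Balaban1988Convergent] (cell paper
B14; held `paper:balaban1988-cmp119-convergent-renormalization`, journal page = PDF page + 242; the display was read
on the x2 render of PDF p. 24 = p. 266).  Cited downstream by number: [Balaban1989LargeFieldI] p. 184 *"For the
functions (1.5) we use the inequality (3.9) [III], only with k replaced by j, and the configuration V^{(k)}_□
replaced by V^{(j)}_□"* — the reason this display gets a named decl (lit-balaban SKELETON §1 protocol).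
Mega-formalization `lit-balaban`, unit `lit-balaban-r11` (CMP 119), SKELETON row `B14.Claim@265` (the (3.9) clause;
(3.7), (3.8) of the same row are `B14Sect3.Ineq37Printed`, `Ineq38Printed`).

THE PRINTED TEXT (p. 266, verbatim): *"Thus χ_k(□) = 1 for □ ⊂ Ω~_{k+1}. For a function from χ_Ax we have a simpler
situation. Using the axial gauge for V^{(k)}_□, we have
|V_k(y,x) − 1| = |V_k(y,x)(V^{(k)}_□(y,x))⁻¹ − 1| < O(1)δ_k = O(1)(A₁/A₀)ε_k < ε_k  for  y ∈ (Ω~_{k+1})^{(k+1)},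
x ∈ B(y), (3.9)
and for A₁/A₀ sufficiently small. Thus χ_Ax((Ω~_{k+1})^{(k)}) = 1."*  Context: `V_k(y,x) = V_k(Γ_{y,x})` is the
contour variable of (0.11) [I] (a product of at most `d(L−1)` bond variables along the tree contour `Γ_{y,x}`,
`x ∈ B(y)`); "the axial gauge for `V^{(k)}_□`" means `V^{(k)}_□(Γ_{y,x}) = 1`, whence the first (in)equality is an
identity; on `□ ⊂ Ω~_{k+1}` the decomposition (3.3) p. 265 restricts `|V_k(b)(V^{(k)}_□(b))⁻¹ − 1| < 2δ_k` bondwise,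
and `δ_k = g_kA₁p₀(g_k) = (A₁/A₀)ε_k` ((1.8) p. 247 at index `k`, (2.4)); the "O(1)" is the number of bond factors
(times the transport), absolute.

WHAT IS TYPED.  (i) The non-commutative estimate behind "`< O(1)δ_k`": in a normed ring, a product of factors of
norm `≤ 1` each `θ`-close to `1` is `(number of factors)·θ`-close to `1` (`norm_list_prod_sub_one_le`,
`norm_list_prod_sub_one_le_mul`) — the reasoning "between (44) and (46)" of [12] that [14] Lemma 1 and this line
use; (ii) the axial-gauge identity step (`ratio_eq_self_of_axial`); (iii) the display as a scalar `Prop` in the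
style of `B14Sect3.Ineq38Printed`: `Ineq39Printed v C δk εk A₀ A₁` := `v < C·δk ∧ C·δk = C·(A₁/A₀)·εk ∧
C·(A₁/A₀)·εk < εk` for ONE real `v` (the left side at one contour) and an explicit `O(1)` constant `C`;
(iv) PROVED assembly: `ineq39_of_bondwise` (members 1–2 from a bondwise `2δ_k`-closeness along `n` factors, with
`C = 2n + 1`… any `C > 2n`), `ineq39_scalar` (member 3 ⇔ the restriction `C·A₁/A₀ < 1`, "for A₁/A₀ sufficiently
small"), `ineq39_conclusion` (`v < ε_k`, i.e. "χ_Ax = 1").  No carrier is introduced; no unproved `Prop`.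
-/

namespace Literature.MathematicalPhysics.QuantumFieldTheory.Balaban1983to89.B14.Ineq39

/-! ## (i) Products of almost-unit factors -/

section Product

variable {𝔸 : Type*} [NormedRing 𝔸]

/-- **The estimate behind "O(1)δ_k"**: if every factor has norm `≤ 1`, then
`‖a₁⋯a_n − 1‖ ≤ Σ_i ‖a_i − 1‖` (induction on `‖ab − 1‖ ≤ ‖a‖‖b − 1‖ + ‖a − 1‖`).
[cite: Balaban1988Convergent, (3.9) p.266] -/
theorem norm_list_prod_sub_one_le :
    ∀ l : List 𝔸, (∀ a ∈ l, ‖a‖ ≤ 1) → ‖l.prod - 1‖ ≤ (l.map fun a => ‖a - 1‖).sum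
  | [], _ => by simp
  | a :: l, h => by
    have ha : ‖a‖ ≤ 1 := h a (by simp)
    have ih := norm_list_prod_sub_one_le l (fun b hb => h b (by simp [hb]))
    rw [List.prod_cons, List.map_cons, List.sum_cons]
    have hsplit : a * l.prod - 1 = a * (l.prod - 1) + (a - 1) := by
      rw [mul_sub, mul_one]; abel
    calc ‖a * l.prod - 1‖ = ‖a * (l.prod - 1) + (a - 1)‖ := by rw [hsplit]
      _ ≤ ‖a * (l.prod - 1)‖ + ‖a - 1‖ := norm_add_le _ _
      _ ≤ ‖a‖ * ‖l.prod - 1‖ + ‖a - 1‖ := by gcongr; exact norm_mul_le _ _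
      _ ≤ 1 * ‖l.prod - 1‖ + ‖a - 1‖ := by gcongr
      _ ≤ ‖a - 1‖ + (l.map fun a => ‖a - 1‖).sum := by linarith

/-- Uniform version: `n` factors of norm `≤ 1`, each `θ`-close to `1`, give a product `nθ`-close to `1` — the
"O(1)" of (3.9) is the number of bond factors of the contour `Γ_{y,x}` (at most `d(L−1)`).
[cite: Balaban1988Convergent, (3.9) p.266] -/
theorem norm_list_prod_sub_one_le_mul (l : List 𝔸) {θ : ℝ} (h1 : ∀ a ∈ l, ‖a‖ ≤ 1)
    (hθ : ∀ a ∈ l, ‖a - 1‖ ≤ θ) : ‖l.prod - 1‖ ≤ l.length * θ := by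
  refine (norm_list_prod_sub_one_le l h1).trans ?_
  have : (l.map fun a => ‖a - 1‖).sum ≤ (l.map fun _ => θ).sum :=
    List.sum_le_sum (fun a ha => hθ a ha)
  refine this.trans (le_of_eq ?_)
  rw [List.map_const', List.sum_replicate, nsmul_eq_mul]

end Product

/-! ## (ii) The axial-gauge identity step -/

section Axial

variable {G : Type*} [Group G]

/-- "Using the axial gauge for `V^{(k)}_□`": if `V^{(k)}_□(Γ_{y,x}) = 1` then
`V_k(y,x)(V^{(k)}_□(y,x))⁻¹ = V_k(y,x)` — the first equality of (3.9).
[cite: Balaban1988Convergent, (3.9) p.266] -/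
theorem ratio_eq_self_of_axial (v w : G) (hw : w = 1) : v * w⁻¹ = v := by
  rw [hw, inv_one, mul_one]

end Axial

/-! ## (iii)–(iv) The display as a scalar chain, and its assembly -/

/-- **(3.9)**, verbatim (p. 266 [PDF 24]): *"|V_k(y,x) − 1| = |V_k(y,x)(V^{(k)}_□(y,x))⁻¹ − 1| < O(1)δ_k =
O(1)(A₁/A₀)ε_k < ε_k for y ∈ (Ω~_{k+1})^{(k+1)}, x ∈ B(y), (3.9) and for A₁/A₀ sufficiently small."*  Typed for ONE
real number `v` (the common value of the two left sides at one contour, cf. `ratio_eq_self_of_axial`) and an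
explicit absolute constant `C` in place of "O(1)"; `δk`, `εk`, `A₀`, `A₁` the constants of (1.8)/(2.4).
[cite: Balaban1988Convergent, (3.9) p.266] -/
def Ineq39Printed (v C δk εk A₀ A₁ : ℝ) : Prop :=
  v < C * δk ∧ C * δk = C * (A₁ / A₀) * εk ∧ C * (A₁ / A₀) * εk < εk

/-- (3.9), members 2–3 (scalars): `δ_k = (A₁/A₀)ε_k` gives the equality; the last member IS the restriction
`C·A₁/A₀ < 1` ("for A₁/A₀ sufficiently small") when `ε_k > 0`. [cite: Balaban1988Convergent, (3.9) p.266, (1.8) p.247] -/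
theorem ineq39_scalar (C δk εk A₀ A₁ : ℝ) (hδ : δk = (A₁ / A₀) * εk) (hε : 0 < εk) :
    C * δk = C * (A₁ / A₀) * εk ∧ (C * (A₁ / A₀) < 1 ↔ C * (A₁ / A₀) * εk < εk) := by
  refine ⟨by rw [hδ, mul_assoc], ?_⟩
  constructor
  · intro h
    have := mul_lt_mul_of_pos_right h hε
    linarith
  · intro h
    by_contra hc
    push Not at hc
    have := mul_le_mul_of_nonneg_right hc hε.le
    linarith

/-- **(3.9) assembled from the bondwise data**: if the contour ratio `V_k(y,x)(V^{(k)}_□(y,x))⁻¹` is a product of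
`n` factors of norm `≤ 1`, each `2δ_k`-close to `1` (the restriction of (3.3) on `□ ⊂ Ω~_{k+1}`, transported),
`δ_k = (A₁/A₀)ε_k > 0`, and `A₁/A₀` is so small that `(2n+1)·A₁/A₀ < 1`, then `Ineq39Printed` holds for
`v = ‖ratio − 1‖` with `C = 2n + 1`. [cite: Balaban1988Convergent, (3.9) p.266, (3.3) p.265] -/
theorem ineq39_of_bondwise {𝔸 : Type*} [NormedRing 𝔸] (l : List 𝔸) {δk εk A₀ A₁ : ℝ}
    (h1 : ∀ a ∈ l, ‖a‖ ≤ 1) (hθ : ∀ a ∈ l, ‖a - 1‖ ≤ 2 * δk) (hδpos : 0 < δk) (hδ : δk = (A₁ / A₀) * εk)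
    (hε : 0 < εk) (hsmall : (2 * l.length + 1) * (A₁ / A₀) < 1) :
    Ineq39Printed ‖l.prod - 1‖ (2 * l.length + 1) δk εk A₀ A₁ := by
  have hb := norm_list_prod_sub_one_le_mul l h1 hθ
  obtain ⟨h2, h3⟩ := ineq39_scalar (2 * l.length + 1) δk εk A₀ A₁ hδ hε
  refine ⟨?_, h2, h3.mp hsmall⟩
  have : (l.length : ℝ) * (2 * δk) < (2 * l.length + 1) * δk := by nlinarith
  linarith

/-- (3.9) ⇒ the bound actually used: `|V_k(y,x) − 1| < ε_k`, verbatim *"Thus χ_Ax((Ω~_{k+1})^{(k)}) = 1."*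
[cite: Balaban1988Convergent, (3.9) p.266] -/
theorem ineq39_conclusion {v C δk εk A₀ A₁ : ℝ} (h : Ineq39Printed v C δk εk A₀ A₁) : v < εk := by
  obtain ⟨h1, h2, h3⟩ := h
  rw [h2] at h1
  exact h1.trans h3

end Literature.MathematicalPhysics.QuantumFieldTheory.Balaban1983to89.B14.Ineq39
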